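import Summits.Ventures.QEC.Census.AdditiveCertCheck
import HarnessLib

/-!
# General-stabilizer certificates, III: the CHUNKED replay (one `decide` per (first qubit, first letter))

`AddCert.check` (file `AdditiveCertCheck.lean`) replays the brute force over all Pauli words of weight `≤ d − 1` in ONE
`scan4`; for the larger calibration codes (`n ≥ 12`, `d ≥ 5`: `Σ_{w ≤ d−1} C(n,w)·3^w ≳ 10⁵` words) that single `decide`
is too big for the kernel tier. As in the CSS checker's `lowerChunk` (CERT-FORMAT §7), the replay splits by the FIRST
non-identity qubit `i` and its letter `ℓ ∈ {X, Z, Y}`: chunk `(i, ℓ)` is the scan of budget `d − 2` over the qubits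
after `i`, started from the one-letter word `ℓ_i`; the `3n` chunks are independent `decide`d theorems and a passing
structural check plus all chunks give the same conclusions as `check`:

* `Reaches4` (what a replay establishes), `reaches4_of_scan4`, `Reaches4.mono`, `reaches4_of_chunks`;
* `AddCert.checkStructure` (everything of `check` except the replay), `AddCert.chunk i bx bz`;
* `AddCert.isAdditiveCode_of_chunks`, `AddCert.minDistance_code_of_chunks`, `AddCert.additiveCodeExists_of_chunks`;
* control: the `[[5,1,3]]` certificate again, through 15 chunks of budget 1 (by `decide`).
-/

namespace Summit.Ventures.QEC.Census

open Matrix Literature.InformationTheory.QuantumCodes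

/-! ## What a replay establishes, and its chunked form -/

/-- `Reaches4 test L b x z`: `test` holds at `(x ⊕ accX S, z ⊕ accZ S)` for every lettered selection `S` of at most `b`
qubits of `L` (in order) — the content of a passing replay, however it was computed. -/
def Reaches4 (test : ℕ → ℕ → Bool) (L : List ℕ) (b x z : ℕ) : Prop :=
  ∀ S : Sel, (S.map Prod.fst).Sublist L → S.length ≤ b → test (x ^^^ accX S) (z ^^^ accZ S) = true

/-- A passing `scan4` reaches everything (= `scan4_complete`). -/
theorem reaches4_of_scan4 {test : ℕ → ℕ → Bool} {L : List ℕ} {b x z : ℕ} (h : scan4 test L b x z = true) :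
    Reaches4 test L b x z :=
  scan4_complete test L b x z h

/-- `Reaches4` is antitone in the budget. -/
theorem Reaches4.mono {test : ℕ → ℕ → Bool} {L : List ℕ} {b b' x z : ℕ} (hb : b ≤ b') (h : Reaches4 test L b' x z) :
    Reaches4 test L b x z :=
  fun S hS hlen => h S hS (hlen.trans hb)

/-- **Chunking by the first lettered qubit**: if `test` holds at the start point and, for every position `i` of `L`
and every non-identity letter `(bx, bz)`, the replay of budget `b` over the positions AFTER `i` started from
`(x, z) ⊕ letter_i` reaches everything, then the replay of budget `b + 1` over `L` reaches everything (a nonempty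
selection has a first entry; an identity first letter changes nothing and is absorbed by induction). -/
theorem reaches4_of_chunks {test : ℕ → ℕ → Bool} :
    ∀ (L : List ℕ) (b x z : ℕ), test x z = true →
      (∀ (i : ℕ) (hi : i < L.length) (bx bz : Bool), (bx || bz) = true →
        Reaches4 test (L.drop (i + 1)) b (x ^^^ (if bx then 2 ^ L[i] else 0)) (z ^^^ (if bz then 2 ^ L[i] else 0))) →
      Reaches4 test L (b + 1) x z := by
  intro L
  induction L with
  | nil =>
    intro b x z h0 _ S hS _
    have : S = [] := by simpa using List.sublist_nil.mp hS
    subst this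
    simpa [accX, accZ] using h0
  | cons j L ih =>
    intro b x z h0 hch S hS hlen
    cases S with
    | nil => simpa [accX, accZ] using h0
    | cons e S' =>
      obtain ⟨j', bx, bz⟩ := e
      rw [List.map_cons] at hS
      rcases List.sublist_cons_iff.1 hS with hskip | ⟨r, hr, hsub⟩
      · -- the selection avoids `j`: induct on the tail of `L`
        refine ih b x z h0 (fun i hi bx' bz' hb => ?_) ((j', bx, bz) :: S') hskip hlen
        have hi' : i + 1 < (j :: L).length := by simpa using hi
        simpa using hch (i + 1) hi' bx' bz' hb
      · obtain ⟨hjj, rfl⟩ := List.cons_eq_cons.1 hr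
        subst hjj
        have hlen' : S'.length ≤ b := by simpa using hlen
        cases bx <;> cases bz
        · -- identity first letter: same word, shorter selection
          have := ih b x z h0 (fun i hi bx' bz' hb => by
            have hi' : i + 1 < (j' :: L).length := by simpa using hi
            simpa using hch (i + 1) hi' bx' bz' hb) S' hsub (by omega)
          simpa [accX, accZ] using this
        · have h := hch 0 (by simp) false true rfl S' (by simpa using hsub) hlen'
          simpa [accX, accZ, Nat.xor_assoc] using h
        · have h := hch 0 (by simp) true false rfl S' (by simpa using hsub) hlen'
          simpa [accX, accZ, Nat.xor_assoc] using h
        · have h := hch 0 (by simp) true true rfl S' (by simpa using hsub) hlen'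
          simpa [accX, accZ, Nat.xor_assoc] using h

namespace AddCert

variable (c : AddCert)

/-! ## The chunked checker -/

/-- The structural part of `check`: everything except the replay. -/
def checkStructure : Bool :=
  c.commOK && c.indepOK && decide (c.rows.length ≤ c.n) &&
    (if c.rows.length < c.n then c.upperOK && c.foundOK else c.zeroOK)

/-- The allow-list the replay uses: the `found` words for `k > 0`, nothing for `k = 0`. -/
def allowList : List (ℕ × ℕ) := if c.rows.length < c.n then c.found.map Prod.fst else []

/-- Chunk `(i, bx, bz)` of the replay (`i < n`, `(bx, bz) ≠ (false, false)`): the words of weight `≤ d − 1` whose first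
non-identity qubit is `i` carrying the letter `X^bx Z^bz`, i.e. the scan of budget `d − 2` over the qubits after `i`
from that one-letter word. -/
def chunk (i : ℕ) (bx bz : Bool) : Bool :=
  scan4 (leaf c.n c.rows c.allowList) ((List.range c.n).drop (i + 1)) (c.d - 2)
    (if bx then 2 ^ i else 0) (if bz then 2 ^ i else 0)

/-! ## Soundness of the chunked form -/

/-- All chunks ⇒ the full replay of budget `d − 1` reaches everything. -/
theorem reaches4_of_allChunks
    (hch : ∀ i : ℕ, i < c.n → ∀ bx bz : Bool, (bx || bz) = true → c.chunk i bx bz = true) :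
    Reaches4 (leaf c.n c.rows c.allowList) (List.range c.n) (c.d - 1) 0 0 := by
  rcases Nat.eq_zero_or_pos (c.d - 1) with h0 | hpos
  · rw [h0]
    intro S hS hlen
    have : S = [] := List.eq_nil_of_length_eq_zero (Nat.le_zero.mp hlen)
    subst this
    simp [leaf, accX, accZ]
  · have hb : c.d - 1 = (c.d - 2) + 1 := by omega
    rw [hb]
    refine reaches4_of_chunks _ _ 0 0 (by simp [leaf]) fun i hi bx bz hb' => ?_
    have hin : i < c.n := by simpa using hi
    have hget : (List.range c.n)[i] = i := by simp
    rw [hget, Nat.zero_xor, Nat.zero_xor]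
    exact reaches4_of_scan4 (hch i hin bx bz hb')

/-- What a reaching replay gives: every `w ∈ Ē` of weight `≤ d − 1` passes the leaf test at its own packed form. -/
theorem leaf_of_reaches4 {allow : List (ℕ × ℕ)} (h : Reaches4 (leaf c.n c.rows allow) (List.range c.n) (c.d - 1) 0 0)
    (w : SympVec c.n) (hw : sympWeight w ≤ c.d - 1) :
    leaf c.n c.rows allow (accX (suppSel c.n w)) (accZ (suppSel c.n w)) = true := by
  have := h (suppSel c.n w) (suppSel_sublist c.n w) (by rw [length_suppSel]; exact hw)
  simpa [Nat.zero_xor] using this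

/-- Lower bound from a reaching replay (as `hasMinDist_of_replay`). -/
theorem hasMinDist_of_reaches4 {allow : List (ℕ × ℕ)}
    (hrep : Reaches4 (leaf c.n c.rows allow) (List.range c.n) (c.d - 1) 0 0)
    (hallow : ∀ a ∈ allow, ofBitPair c.n a.1 a.2 ∈ c.code) : HasMinDist c.code c.d := by
  intro w hw hw'
  by_contra hlt
  have hle : sympWeight w ≤ c.d - 1 := by omega
  have hleaf := c.leaf_of_reaches4 hrep w hle
  have hwxz : ofBitPair c.n (accX (suppSel c.n w)) (accZ (suppSel c.n w)) = w := ofBitPair_acc_suppSel c.n w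
  rcases leaf_cases hleaf with hsyn | ⟨hx0, hz0⟩ | hmem
  · have := (c.mem_sympDual_code_iff (accX (suppSel c.n w), accZ (suppSel c.n w))).1 (by rw [hwxz]; exact hw)
    rw [hsyn] at this
    exact Bool.false_ne_true this
  · apply hw'
    rw [← hwxz, hx0, hz0, ofBitPair_zero]
    exact Submodule.zero_mem _
  · exact hw' (hwxz ▸ hallow _ hmem)

/-- **Soundness, chunked (CRSS Thm. 1 form)**: structural check + all `3n` chunks ⇒ `[[n, n − |rows|, d]]`. -/
theorem isAdditiveCode_of_chunks (hs : c.checkStructure = true)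
    (hch : ∀ i : ℕ, i < c.n → ∀ bx bz : Bool, (bx || bz) = true → c.chunk i bx bz = true) :
    IsAdditiveCode c.code c.k c.d := by
  have hrep := c.reaches4_of_allChunks hch
  simp only [checkStructure, Bool.and_eq_true, decide_eq_true_eq] at hs
  obtain ⟨⟨⟨hcomm, hind⟩, hle⟩, hrest⟩ := hs
  have hso := c.isSelfOrthogonal_code hcomm
  have hdim := c.finrank_code hind
  refine ⟨hso, by rw [hdim, k]; omega, ?_, ?_⟩
  · by_cases hk : c.rows.length < c.n
    · rw [if_pos hk, Bool.and_eq_true] at hrest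
      rw [allowList, if_pos hk] at hrep
      exact c.hasMinDist_of_reaches4 hrep (c.allow_mem_code hrest.2)
    · have hSS : sympDual c.code = c.code := by
        refine (Submodule.eq_of_le_of_finrank_le hso ?_).symm
        have := finrank_sympDual_add c.code
        omega
      intro w hw hw'
      exact absurd (hSS ▸ hw) hw'
  · intro hk0 v hv hv0
    have hk : ¬ c.rows.length < c.n := fun hlt => by simp [k] at hk0; omega
    rw [allowList, if_neg hk] at hrep
    by_contra hlt
    have hle' : sympWeight v ≤ c.d - 1 := by omega
    have hleaf := c.leaf_of_reaches4 hrep v hle'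
    have hwxz := ofBitPair_acc_suppSel c.n v
    rcases leaf_cases hleaf with hsyn | ⟨h1, h2⟩ | hmem
    · have := (c.mem_sympDual_code_iff (accX (suppSel c.n v), accZ (suppSel c.n v))).1
        (by rw [hwxz]; exact hso hv)
      rw [hsyn] at this
      exact Bool.false_ne_true this
    · apply hv0
      rw [← hwxz, h1, h2, ofBitPair_zero]
    · exact absurd hmem List.not_mem_nil

/-- **Soundness, chunked, `k > 0`**: the exact minimum distance. -/
theorem minDistance_code_of_chunks (hs : c.checkStructure = true)
    (hch : ∀ i : ℕ, i < c.n → ∀ bx bz : Bool, (bx || bz) = true → c.chunk i bx bz = true)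
    (hk : c.rows.length < c.n) : minDistance c.code = c.d := by
  have hrep := c.reaches4_of_allChunks hch
  rw [allowList, if_pos hk] at hrep
  simp only [checkStructure, if_pos hk, Bool.and_eq_true, decide_eq_true_eq] at hs
  obtain ⟨⟨⟨-, -⟩, -⟩, hup, hfound⟩ := hs
  simp only [upperOK, Bool.and_eq_true, beq_iff_eq] at hup
  obtain ⟨⟨⟨hsyn, hwt⟩, hnm⟩, hanti⟩ := hup
  refine minDistance_eq_of_witness ((c.mem_sympDual_code_iff c.witness).2 hsyn) ?_ ?_
    (c.hasMinDist_of_reaches4 hrep (c.allow_mem_code hfound))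
  · intro hmem
    have hu := (c.mem_sympDual_code_iff c.nonmember).2 hnm
    have h0 : sympInner (ofBitPair c.n c.witness.1 c.witness.2)
        (ofBitPair c.n c.nonmember.1 c.nonmember.2) = 0 := (mem_sympDual_iff.1 hu) _ hmem
    rw [sympInner_comm] at h0
    exact sympInner_ne_zero_of_sympParity_eq_one c.n hanti h0
  · rw [sympWeight_ofBitPair_eq_pw, hwt]

/-- The parameters are realised (chunked form). -/
theorem additiveCodeExists_of_chunks (hs : c.checkStructure = true)
    (hch : ∀ i : ℕ, i < c.n → ∀ bx bz : Bool, (bx || bz) = true → c.chunk i bx bz = true) :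
    AdditiveCodeExists c.n c.k c.d :=
  ⟨c.code, c.isAdditiveCode_of_chunks hs hch⟩

end AddCert

/-! ## Control: `[[5,1,3]]` through 15 chunks -/

/-- The structural check of the `[[5,1,3]]` certificate passes. -/
theorem checkStructure_certC513 : certC513.checkStructure = true := by decide

/-- All 15 chunks `(i, ℓ)`, `i < 5`, `ℓ ∈ {X, Z, Y}`, of the `[[5,1,3]]` replay pass (one `decide`; a large code would
state one theorem per chunk and assemble with `interval_cases`). -/
theorem chunks_certC513 : ∀ i : ℕ, i < 5 → ∀ bx bz : Bool, (bx || bz) = true → certC513.chunk i bx bz = true := by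
  decide

/-- `[[5,1,3]]` again, via the chunked soundness: exact distance `3`. -/
theorem minDistance_certC513_chunks : minDistance certC513.code = 3 :=
  certC513.minDistance_code_of_chunks checkStructure_certC513 chunks_certC513 (by decide)

end Summit.Ventures.QEC.Census
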